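import Literature.AnabelianGeometry.EtaleTheta.Discharge.Sec4Prop42SubZetaA
import Literature.AnabelianGeometry.EtaleTheta.Discharge.Sec4NonVacuityPipeline
import HarnessLib

/-!
# [EtTh] §4 at the toy setting: Prop 4.2 (iv) HOLDS, completing the picture "(i)(ii)(iv), 4.3, 4.4 hold —
# (iii) fails" (consistency witness, part 5)

S. Mochizuki, *The étale theta function and its Frobenioid-theoretic manifestations*, Publ. RIMS **45**
(2009) [MochizukiEtTh2009], §4, Prop 4.2 (iv) pp.88–90 (PDF); sub-DAG `plan/L2/SUBDAG-EtTh-Prop42.md`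
§C rows L05 `UnitRootsUpstairs` / L06 `ZetaA`.

CONSISTENCY WITNESS, TOY — joint satisfiability of the §4 hypothesis packages; consistency ≠ faithfulness.
Sequel of this seat's `Sec4NonVacuity*` files (p418516, p418792, p421581, p422428).  At the perfect toy
tempered Frobenioid every unit group `O^×(A)` is TRIVIAL (`Toy.eq_one_of_mem_units`: a base-identity linear
automorphism `(1, id, 0, u)` has `Div_B(u) = 0`, hence `u = (b, 0)` with `b·𝔭 = 0` in `(ℚ_{≥0})^gp`, so
`b = 0` — the divisor map `ℤ → (ℚ_{≥0})^gp` is injective), so abc-iut-w4-d044's sub-node L05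
`UnitRootsUpstairs` holds there trivially (`Toy.unitRootsUpstairs`), and d044's closer
`prop42_iv_mkOfModelCanonical_of_unitRootsUpstairs` (p418374) FIRES: **`Toy.prop42_iv`**.  Together with
`Toy.sec4_typed_conclusions` (p421581) and `Toy.not_prop42_iii` (p422428):

* `Toy.sec4_picture` — at ONE explicit `BiKummerSetting` (a Frobenioid, built through `mkOfModelCanonical`):
  Prop 4.2 (i) ∧ (ii) ∧ (iv) ∧ Prop 4.3 (ii) ∧ (iii) ∧ Thm 4.4 (i)–(iv) HOLD (this file), while Prop 4.2 (iii)
  FAILS there (`Toy.not_prop42_iii`, `Sec4NonVacuityNoRoots.lean`, p422428 — not re-imported here).  So (a)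
  the typed §4 statement set minus (iii) is jointly consistent with the setting, every landed closer's
  hypothesis list is satisfiable, and (b) Prop 4.2 (iii) is independent of all of them — the covering input
  L01a (ERRATUM E2) is the one essential extra ingredient of §4.

HONEST LIMITS as before (one-object base, trivial [FrdI] vocabularies, `(N,H)`-slot `True`; not a curve).
Proof-only: no definition, no named fact, no instance, no `sorry`.  Nothing here bears on, or takes a side
on, [IUTchIII] Cor. 3.12.
-/

noncomputable section

namespace Literature.AnabelianGeometry.EtaleTheta

open CategoryTheory Opposite Literature.AlgebraicGeometry.Frobenioids
open scoped NNRat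

namespace Toy

/-! ## Units of the toy are trivial -/

/-- The divisor map of the toy, `ℤ → (ℚ_{≥0})^gp`, `n ↦ n·𝔭`, is injective (read through the canonical
homomorphism `(ℚ_{≥0})^gp → ℚ`). [cite: MochizukiEtTh2009, Def 3.3 p.73] -/
theorem divHomQ_injective : Function.Injective divHomQ := by
  -- `L : (ℚ≥0)^gp → ℚ` extending the coercion
  let c : Multiplicative ℚ≥0 →* Multiplicative ℚ := AddMonoidHom.toMultiplicative NNRat.coeHom
  let L : Algebra.GrothendieckGroup (Multiplicative ℚ≥0) →* Multiplicative ℚ :=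
    Algebra.GrothendieckGroup.lift c
  have hL : ∀ x : Multiplicative ℚ≥0, L (Algebra.GrothendieckGroup.of x) = c x := by
    intro x
    have h : L.comp Algebra.GrothendieckGroup.of = c := by
      rw [← Algebra.GrothendieckGroup.lift_symm_apply]
      exact Equiv.symm_apply_apply _ _
    exact DFunLike.congr_fun h x
  have hLdiv : ∀ n : Multiplicative ℤ, L (divHomQ n) = Multiplicative.ofAdd ((Multiplicative.toAdd n : ℤ) : ℚ) := by
    intro n
    rw [divHomQ, zpowersHom_apply, map_zpow, hL]
    change Multiplicative.ofAdd (((Multiplicative.toAdd (Multiplicative.ofAdd (1 : ℚ≥0)) : ℚ≥0) : ℚ)) ^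
        Multiplicative.toAdd n = _
    rw [toAdd_ofAdd, NNRat.coe_one, ← ofAdd_zsmul, zsmul_eq_mul, mul_one]
  intro m n h
  have h' := congrArg L h
  rw [hLdiv, hLdiv] at h'
  have h'' : ((Multiplicative.toAdd m : ℤ) : ℚ) = (Multiplicative.toAdd n : ℤ) :=
    Multiplicative.ofAdd.injective h'
  exact Multiplicative.toAdd.injective (by exact_mod_cast h'')

/-- **Every unit group `O^×(A)` of the toy tempered Frobenioid is trivial**: a base-identity linear
automorphism is `(1, id, 0, u)` with `Div_B(u) = 0` ([FrdI] Thm 5.2 relation (d), `Φ` divisorial), so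
`u = (b, 0)` with `b·𝔭 = 0`, i.e. `b = 0`. [cite: MochizukiFrdI2008, Thm. 5.2(ii) p.101] -/
theorem eq_one_of_mem_units {A : temperedFrobenioidQ.category} {w : Aut A}
    (hw : w ∈ ModelFrobenioid.units A) : w = 1 := by
  apply ModelFrobenioid.eq_one_of_mem_units_of_unit_eq_one divisorMonoidQ_isDivisorial hw
  -- `Div_B(u_w) = of (Div w) = 1`
  have hdiv : ModelFrobenioid.div w.hom = 1 :=
    ModelFrobenioid.div_eq_one_of_mem_units (divisorMonoidQ_isDivisorial A.base).isSharp hw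
  have hB : divB temperedFrobenioidQ.divisorMonoid temperedFrobenioidQ.ratFnFunctor
      temperedFrobenioidQ.divBNatTrans (op A.base) (ModelFrobenioid.unit w.hom) = 1 := by
    rw [← ModelFrobenioid.of_div_eq_divB_unit_of_mem_units hw, hdiv, map_one]
  -- the second component of `u_w` is `Div_B(u_w) = 1`, the first has divisor `ΦgpToRlog 1 = 1`
  have h2 : (ModelFrobenioid.unit w.hom).1.2 = 1 := hB
  have h1 : (ModelFrobenioid.unit w.hom).1.1 = 1 := by
    have hrel : realifiedQ.divΛ _ (ModelFrobenioid.unit w.hom).1.1 =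
        temperedFrobenioidQ.ΦgpToRlog (op A.base) (ModelFrobenioid.unit w.hom).1.2 :=
      (ModelFrobenioid.unit w.hom).2
    rw [h2, map_one] at hrel
    exact divHomQ_injective (hrel.trans (map_one divHomQ).symm)
  exact Subtype.ext (Prod.ext h1 h2)

/-- The same for the §4 spelling `S.units` (= `PreFrobenioid.unitsSubgroup`).
[cite: MochizukiEtTh2009, Def 4.1 p.87] -/
theorem eq_one_of_mem_units' {A : biKummerSetting.C} {w : Aut A} (hw : w ∈ biKummerSetting.units A) :
    w = 1 :=
  eq_one_of_mem_units ⟨hw.1, hw.2⟩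

/-! ## L05 and Prop 4.2 (iv) at the toy -/

/-- **Sub-node L05 `UnitRootsUpstairs` HOLDS at the toy** (trivially: all units are `1 = 1^N`).
[cite: MochizukiEtTh2009, Prop 4.2 p.90] -/
theorem unitRootsUpstairs :
    BiKummerSetting.Prop42Sub.UnitRootsUpstairs biKummerSetting
      (fun φ x => temperedFrobenioidQ.pullFracModel φ x) := by
  intro B f P N R x x' _ hx' _
  refine ⟨1, Subgroup.one_mem _, ?_⟩
  rw [one_pow, eq_one_of_mem_units' hx']

/-- **Prop 4.2 (iv) HOLDS at the toy** for the genuine transport `pullFracModel`, by abc-iut-w4-d044's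
closer `prop42_iv_mkOfModelCanonical_of_unitRootsUpstairs` (L06 `ZetaA` ⇐ L05, `Φ` divisorial) — its
hypothesis list is satisfiable. [cite: MochizukiEtTh2009, Prop 4.2 p.89] -/
theorem prop42_iv :
    biKummerSetting.Prop42_iv (fun φ x => temperedFrobenioidQ.pullFracModel φ x) :=
  BiKummerSetting.prop42_iv_mkOfModelCanonical_of_unitRootsUpstairs temperedGroup temperedFrobenioidQ
    temperedFrobenioidQ_monoidType temperedFrobenioidQ_isPerfect (fun _ => True) (fun _ _ => 1)
    (fun _ _ _ => ⟨1, Subsingleton.elim (h := ⟨fun _ _ => Iso.ext (Subsingleton.elim _ _)⟩) _ _⟩)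
    (fun _ _ _ => True) Aodot isFrobeniusTrivial_Aodot trivial divisorMonoidQ_isDivisorial
    unitRootsUpstairs

/-- **The §4 picture at one explicit setting**: Prop 4.2 (i), (ii), (iv), Prop 4.3 (ii), (iii),
Thm 4.4 (i)–(iv) HOLD at `Toy.biKummerSetting` (a Frobenioid, `Φ` divisorial and perfect, `B` group-like,
built through `mkOfModelCanonical`) — consistency of the typed statement set minus (iii) and satisfiability
of every landed §4 closer's inputs; (iii) fails there by `Toy.not_prop42_iii` (p422428), whence the covering
input L01a is essential. [cite: MochizukiEtTh2009, Prop 4.2 p.88] -/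
theorem sec4_picture :
    biKummerSetting.Prop42_i ∧ biKummerSetting.Prop42_ii ∧
      biKummerSetting.Prop42_iv (fun φ x => temperedFrobenioidQ.pullFracModel φ x) ∧
      (biKummerSetting.Prop43_ii fun {_ _} φ => temperedFrobenioidQ.pullFracModel φ) ∧
      (biKummerSetting.Prop43_iii fun {_ _} φ => temperedFrobenioidQ.pullFracModel φ) ∧
      BiKummerSetting.Thm44_i thm44HypId ∧
      BiKummerSetting.Thm44_ii thm44HypId (fun _ => MulEquiv.refl _) ∧
      BiKummerSetting.Thm44_iii thm44HypId (fun _ => MulEquiv.refl _) ∧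
      BiKummerSetting.Thm44_iv thm44HypId (fun _ => MulEquiv.refl _)
        (fun {_ _} φ => temperedFrobenioidQ.pullFracModel φ) (fun {_ _} φ => temperedFrobenioidQ.pullFracModel φ) :=
  ⟨prop42_i, prop42_ii, prop42_iv, prop43_ii, prop43_iii, thm44_i_id, thm44_ii_id,
    thm44_iii_id, thm44_iv_id⟩

end Toy

end Literature.AnabelianGeometry.EtaleTheta

end
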